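import Summits.PneNP.PneNP.Theorems.ChebyshevTracialDesignDimTwoDenseCell
import HarnessLib

/-!
# Cell pnp-psdrank, route `ChebyshevTracialDesign`: the `r = 2` dense cell in the CELL'S VOCABULARY — homogeneous matching side + weighted
# spectral non-tightness

Brick 63 (prover g11) for the crux `TracialDecayExp20` (stmt-PneNP-19878): the form of brick 62 (`denseCell_dim_two_value_le`) whose hypotheses are
the ones the exp-scale dense cell hred_exp (brick 57) actually supplies — a matching-side trace weight `tr(Y_M)/2` that is `(PM_n, e)`-HOMOGENEOUS in the
sense of Kupavskii–Zakharov (`IsRelHomogeneousW`) and dense — plus ONE analytic input stated as a hypothesis, the WEIGHTED quantitative spectral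
non-tightness (SNT-q)_w at homogeneity parameter `4e`: every `[0,1]` cut weight of mass `≥ ε·#t-cuts` and every `[0,1]` matching weight that is
`(PM_n, 4e)`-homogeneous of mass `≥ ν·#PM_n` have an ACTIVE TIGHT PAIR (for SETS this is the cell's SNT, bricks 27 + 46, mod Keevash–Lifshitz; the
weighted form is MEMO-14 §5 (d)(1)).
* §1 `isRelHomogeneousW_of_le_of_frac` — a sub-weight carrying a `1/k` fraction of a `(𝒜, τ)`-homogeneous weight is `(𝒜, kτ)`-homogeneous
  (brick 59 had `k = 2`); `wmass_ext_eq_sum` — bookkeeping between weights on `PMatch n` and on edge sets.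
* §2 `denseCell_dim_two_of_homogeneous` — `(X, Y)` tight psd of dimension `2` on the `t`-cuts, `tr(Y)/2` `(PM, e)`-homogeneous with
  `Σ_M tr(Y_M)/2 ≥ 4ν·#PM`, (SNT-q)_w at `(4e, ε, ν)`, `TracialValueLEAt W γ 1` ⇒ `Σ W·tr(X_U Y_M) ≤ 6γ + 4·B_v·ε`.
[cite: KupavskiiZakharov2022, §2] [cite: Rothvoss2017, §2 (PDF p. 6)] [cite: BrietDadushPokutta2014, Thm. 6 (§3)]
Stature: support/instrument (no defs). WHAT THIS IS NOT: not the dense cell for `r > 2`; the weighted (SNT-q) is a hypothesis; nothing on psd rank,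
no P-vs-NP content. Supports stmt-PneNP-19878.
-/

set_option linter.dupNamespace false -- `Summit.PneNP.PneNP.…`: summit = sub-problem (D-0017)

noncomputable section

namespace Summit.PneNP.PneNP.Theorems.ChebyshevTracialDesignDimTwoDenseCellHomogeneous

open Finset Matrix Literature.Barriers.PneNP Literature.Combinatorics.Optimization
open Literature.Combinatorics.SetFamily
open Summit.PneNP.PneNP.Theorems.ChebyshevTracialDesignDimTwoDenseCell (denseCell_dim_two_value_le)

/-! ### §1 Homogeneity of fractional sub-weights; edge-set bookkeeping -/

/-- **A sub-weight carrying a `1/k` fraction of a homogeneous weight is homogeneous (factor `k`).** If `y` is `(𝒜, τ)`-homogeneous on `ℱ`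
(`τ ≥ 0`), `0 ≤ y' ≤ y` pointwise, `k ≥ 1` and `y(ℱ) ≤ k·y'(ℱ)`, then `y'` is `(𝒜, kτ)`-homogeneous on `ℱ`. [cite: KupavskiiZakharov2022, §2] -/
theorem isRelHomogeneousW_of_le_of_frac {α : Type*} [DecidableEq α] {τ k : ℝ} (hτ : 0 ≤ τ) (hk : 1 ≤ k) {𝒜 ℱ : Finset (Finset α)}
    {y y' : Finset α → ℝ} (hy : IsRelHomogeneousW τ 𝒜 y ℱ) (h0 : ∀ A, 0 ≤ y' A) (hle : ∀ A, y' A ≤ y A)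
    (hfrac : wmass y ℱ ≤ k * wmass y' ℱ) : IsRelHomogeneousW (k * τ) 𝒜 y' ℱ := by
  intro S
  rcases S.eq_empty_or_nonempty with rfl | hS
  · simp only [supersets_emptyset, card_empty, pow_zero, one_mul]
    exact le_of_eq (mul_comm _ _)
  have hk1 : 1 ≤ S.card := card_pos.2 hS
  have h1 : wmass y' (supersets ℱ S) ≤ wmass y (supersets ℱ S) := sum_le_sum fun A _ => hle A
  have hA : (0 : ℝ) ≤ (𝒜.card : ℝ) := Nat.cast_nonneg _
  have hAS : (0 : ℝ) ≤ ((supersets 𝒜 S).card : ℝ) := Nat.cast_nonneg _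
  have hτk : (0 : ℝ) ≤ τ ^ S.card := pow_nonneg hτ _
  have h2 : k * τ ^ S.card ≤ (k * τ) ^ S.card := by
    rw [mul_pow]
    exact mul_le_mul_of_nonneg_right (by
      calc k = k ^ 1 := (pow_one _).symm
        _ ≤ k ^ S.card := pow_le_pow_right₀ hk hk1) hτk
  have hw' : 0 ≤ wmass y' ℱ := wmass_nonneg h0 ℱ
  calc wmass y' (supersets ℱ S) * 𝒜.card ≤ wmass y (supersets ℱ S) * 𝒜.card := mul_le_mul_of_nonneg_right h1 hA
    _ ≤ τ ^ S.card * (supersets 𝒜 S).card * wmass y ℱ := hy S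
    _ ≤ τ ^ S.card * (supersets 𝒜 S).card * (k * wmass y' ℱ) := mul_le_mul_of_nonneg_left hfrac (mul_nonneg hτk hAS)
    _ = (k * τ ^ S.card) * (supersets 𝒜 S).card * wmass y' ℱ := by ring
    _ ≤ (k * τ) ^ S.card * (supersets 𝒜 S).card * wmass y' ℱ :=
        mul_le_mul_of_nonneg_right (mul_le_mul_of_nonneg_right h2 hAS) hw'

variable {n : ℕ}

/-- The mass of the edge-set extension `M ↦ z ⟨M, _⟩` (zero off the perfect matchings) over all perfect matchings is `Σ_M z M`. [folklore] -/
theorem wmass_ext_eq_sum (z : PMatch n → ℝ) :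
    wmass (fun M : Finset (Sym2 (Fin n)) => if hM : IsPMOn (univ : Finset (Fin n)) M then z ⟨M, hM⟩ else 0)
      ((univ : Finset (PMatch n)).image Subtype.val) = ∑ M, z M := by
  rw [wmass_def, sum_image (fun M _ M' _ h => Subtype.ext h)]
  refine sum_congr rfl fun M _ => ?_
  rw [dif_pos M.2]

/-! ### §2 The `r = 2` dense cell with a homogeneous matching side -/

/-- **THE `r = 2` DENSE CELL, homogeneous form.** Let `W = levelWeight n t C w`, `Σ|w_c| ≤ B_v`, `TracialValueLEAt W γ 1`, `(X, Y)` a tight-orthogonal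
psd rectangle of dimension `2` supported on the `t`-cuts whose matching trace weight `tr(Y_M)/2` is `(PM_n, e)`-homogeneous with
`Σ_M tr(Y_M)/2 ≥ 4ν·#PM_n`, and assume the weighted quantitative non-tightness `hSNTw` at `(4e, ε, ν)`. Then
`Σ_U Σ_M W(U,M)·tr(X_U Y_M) ≤ 6γ + 4·B_v·ε`. [cite: KupavskiiZakharov2022, §2] [cite: Rothvoss2017, §2 (PDF p. 6)] -/
theorem denseCell_dim_two_of_homogeneous {t : ℕ} (C : Finset ℕ) (w : ℕ → ℝ) {Bv γ ε ν : ℝ} (hBv : ∑ c ∈ C, |w c| ≤ Bv) (hε : 0 < ε)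
    (hγ : TracialValueLEAt (levelWeight n t C w) γ 1)
    {X : OddSet n → Matrix (Fin 2) (Fin 2) ℝ} {Y : PMatch n → Matrix (Fin 2) (Fin 2) ℝ} (hXY : IsPsdRect X Y)
    (hXt : ∀ U, U.1.card ≠ t → X U = 0)
    (hYhom : IsRelHomogeneousW (Real.exp 1) (perfectMatchings (univ : Finset (Fin n)))
      (fun M : Finset (Sym2 (Fin n)) => if hM : IsPMOn (univ : Finset (Fin n)) M then (Y ⟨M, hM⟩).trace / 2 else 0)
      ((univ : Finset (PMatch n)).image Subtype.val))
    (hν : 4 * (ν * (Fintype.card (PMatch n) : ℝ)) ≤ ∑ M, (Y M).trace / 2)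
    (hSNTw : ∀ (x : OddSet n → ℝ) (z : PMatch n → ℝ), (∀ U, 0 ≤ x U ∧ x U ≤ 1) → (∀ U, U.1.card ≠ t → x U = 0) →
      ε * ((univ.filter fun U : OddSet n => U.1.card = t).card : ℝ) ≤ ∑ U, x U → (∀ M, 0 ≤ z M ∧ z M ≤ 1) →
      IsRelHomogeneousW (4 * Real.exp 1) (perfectMatchings (univ : Finset (Fin n)))
        (fun M : Finset (Sym2 (Fin n)) => if hM : IsPMOn (univ : Finset (Fin n)) M then z ⟨M, hM⟩ else 0)
        ((univ : Finset (PMatch n)).image Subtype.val) →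
      ν * (Fintype.card (PMatch n) : ℝ) ≤ ∑ M, z M → ∃ U M, cc U M = 1 ∧ 0 < x U ∧ 0 < z M) :
    ∑ U, ∑ M, levelWeight n t C w U M * (X U * Y M).trace ≤ 6 * γ + 4 * Bv * ε := by
  classical
  refine denseCell_dim_two_value_le C w hBv hε hγ hXY hXt fun x y' hx01 hxt hxd hy'01 hquarter => ?_
  have htr1 : ∀ M, (Y M).trace / 2 ≤ 1 := fun M => by
    have h := (hXY.2.1 M).2.trace_nonneg
    rw [trace_sub, trace_one, Fintype.card_fin] at h
    norm_num at h
    linarith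
  refine hSNTw x y' hx01 hxt hxd (fun M => ⟨(hy'01 M).1, (hy'01 M).2.trans (htr1 M)⟩) ?_ (by linarith)
  -- homogeneity of the sub-weight: factor 4
  refine isRelHomogeneousW_of_le_of_frac (Real.exp_pos 1).le (by norm_num : (1 : ℝ) ≤ 4) hYhom ?_ ?_ ?_
  · intro A
    by_cases hA : IsPMOn (univ : Finset (Fin n)) A
    · simp only [hA, dif_pos]; exact (hy'01 ⟨A, hA⟩).1
    · simp only [hA, dif_neg, not_false_eq_true, le_refl]
  · intro A
    by_cases hA : IsPMOn (univ : Finset (Fin n)) A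
    · simp only [hA, dif_pos]; exact (hy'01 ⟨A, hA⟩).2
    · simp only [hA, dif_neg, not_false_eq_true, le_refl]
  · have e1 := wmass_ext_eq_sum (n := n) (fun M => (Y M).trace / 2)
    have e2 := wmass_ext_eq_sum (n := n) y'
    rw [e1, e2]
    exact hquarter

end Summit.PneNP.PneNP.Theorems.ChebyshevTracialDesignDimTwoDenseCellHomogeneous
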